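import Literature.NumberTheory.DiophantineGeometry.AbcShapeGeometrySets
import Literature.NumberTheory.DiophantineGeometry.AbcShapeSubBox

-- Summit.ABC.ABC is the mandated summit-side namespace (single-conjunct summit); the lakefile sets the same option tree-wide.
set_option linter.dupNamespace false

/-!
# The multiplicative energy in product variables (crux stmt-ABC-2757, stub `de_energy_le_productVars`)

Stub H1 of the DE tool for the line `critical-kloosterman-powerful-moduli` of the crux
`Summit.ABC.ABC.Theses.TwistAmplification.MazurKaneLaw`.  After Cauchy–Schwarz the DE tool has to
bound the mixed multiplicative energy
`#R = #{(r₂, r₃, r₂', r₃') : m(r₂') n(r₃) ≡ m(r₂) n(r₃') (mod q), units mod q}`,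
`m(r) = c₂ offVal_{i₀}(r)`, `n(r) = c₃ offVal_{i₀}(r)`, over the sub-boxes frozen at the linear
coordinate `i₀`.  Writing `offVal_{i₀}(r) = r(i₁)² · offVal_{i₀,i₁}(r)` (the coordinate `i₁` of value
`1` enters squared), the congruence reads `A² F(Cp) ≡ B² F(Dp) (mod q)` with the *product variables*
`A = r₂'(i₁) r₃(i₁)`, `B = r₂(i₁) r₃'(i₁)` and the frozen pairs `Cp, Dp`; the map
`p ↦ ((A, Cp), (B, Dp))` has fibres of size `≤ τ(A) τ(B) ≤ Dτ²` (a tuple of the sub-box is recovered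
from its freezing at `i₁` and its `i₁`-coordinate, and `(r₂'(i₁), r₃(i₁))` runs over the divisor
antidiagonal of `A`).  Hence `#R ≤ Dτ² · #G₀`
(`Summit.ABC.ABC.Theorems.MazurKaneLaw.de_energy_le_productVars`), where `G₀` is the set of
`((A, Cp), (B, Dp))` with the congruence and the unit conditions; later pieces count `G₀` by lattices.

No new definitions.
-/

namespace Summit.ABC.ABC.Theorems.MazurKaneLaw

open Finset
open Literature.NumberTheory.DiophantineGeometry
open Literature.NumberTheory.DiophantineGeometry.AbcShapes

/-- `offVal_{i₀}(r) = r(i₁)² · offVal_{i₀,i₁}(r)` when `i₀` has value `0` and `i₁` has value `1`.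
[folklore] -/
theorem de_offVal_singleton_eq_sq_mul {d : ℕ} (i₀ i₁ : Fin d) (h0 : (i₀ : ℕ) = 0)
    (h1 : (i₁ : ℕ) = 1) (r : Fin d → ℕ) :
    offVal {i₀} r = r i₁ ^ 2 * offVal ({i₀, i₁} : Finset (Fin d)) r := by
  have hne : i₁ ≠ i₀ := Fin.ne_of_val_ne (by omega)
  have hS : (({i₀} : Finset (Fin d))ᶜ) = insert i₁ (({i₀, i₁} : Finset (Fin d))ᶜ) := by
    ext i
    simp only [mem_compl, mem_insert, mem_singleton, not_or]
    constructor
    · intro h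
      by_cases hi : i = i₁
      · exact Or.inl hi
      · exact Or.inr ⟨h, hi⟩
    · rintro (h | h)
      · rw [h]; exact hne
      · exact h.1
  have hnot : i₁ ∉ (({i₀, i₁} : Finset (Fin d))ᶜ) :=
    fun h => (mem_compl.mp h) (mem_insert_of_mem (mem_singleton_self i₁))
  have h2 : (i₁ : ℕ) + 1 = 2 := by omega
  simp only [offVal]
  rw [hS, prod_insert hnot, h2]

/-- Freezing the coordinate `i₁` does not change `offVal_{i₀,i₁}`. [folklore] -/
theorem de_offVal_pair_freezeOn {d : ℕ} (i₀ i₁ : Fin d) (X u : Fin d → ℕ) :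
    offVal ({i₀, i₁} : Finset (Fin d)) (freezeOn {i₁} X u) = offVal ({i₀, i₁} : Finset (Fin d)) u :=
  prod_congr rfl fun i hi => by
    have hi' : i ≠ i₁ := fun h =>
      (mem_compl.mp hi) (by rw [h]; exact mem_insert_of_mem (mem_singleton_self i₁))
    simp only [freezeOn, mem_singleton, hi', if_false]

/-- The key identity `m(u) n(v) = (u(i₁) v(i₁))² · F(frozen pair)` in product variables. [folklore] -/
theorem de_prodVars_identity {d : ℕ} (i₀ i₁ : Fin d) (h0 : (i₀ : ℕ) = 0) (h1 : (i₁ : ℕ) = 1)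
    (c₂ c₃ : ℕ) (Y Z u v : Fin d → ℕ) :
    c₂ * offVal {i₀} u * (c₃ * offVal {i₀} v) =
      (u i₁ * v i₁) ^ 2 * (c₂ * offVal ({i₀, i₁} : Finset (Fin d)) (freezeOn {i₁} Y u) *
        (c₃ * offVal ({i₀, i₁} : Finset (Fin d)) (freezeOn {i₁} Z v))) := by
  rw [de_offVal_pair_freezeOn, de_offVal_pair_freezeOn, de_offVal_singleton_eq_sq_mul i₀ i₁ h0 h1 u,
    de_offVal_singleton_eq_sq_mul i₀ i₁ h0 h1 v]
  ring

/-- Freezing `i₁` sends the sub-box frozen on `{i₀}` into the sub-box frozen on `{i₀, i₁}`.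
[folklore] -/
theorem de_freezeOn_mem_subBox_pair {d : ℕ} {i₀ i₁ : Fin d} {X u : Fin d → ℕ}
    (hu : u ∈ subBox {i₀} X) : freezeOn {i₁} X u ∈ subBox ({i₀, i₁} : Finset (Fin d)) X := by
  rw [mem_subBox] at hu ⊢
  intro i
  constructor
  · intro hi
    by_cases h : i = i₁
    · subst h; simp [freezeOn]
    · rw [mem_insert, mem_singleton] at hi
      rcases hi with hi | hi
      · simp only [freezeOn, mem_singleton, h, if_false]
        rw [hi]
        exact (hu i₀).1 (mem_singleton_self i₀)
      · exact absurd hi h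
  · intro hi
    rw [mem_insert, mem_singleton, not_or] at hi
    simp only [freezeOn, mem_singleton, hi.2, if_false]
    exact (hu i).2 (fun h => hi.1 (mem_singleton.mp h))

/-- The product variable `u(i₁) v(i₁)` lies in `[1, 4 Y(i₁) Z(i₁)]`. [folklore] -/
theorem de_mul_mem_Icc {d : ℕ} {i₀ i₁ : Fin d} {Y Z u v : Fin d → ℕ}
    (hi : i₁ ∉ ({i₀} : Finset (Fin d))) (hu : u ∈ subBox {i₀} Y) (hv : v ∈ subBox {i₀} Z) :
    u i₁ * v i₁ ∈ Finset.Icc 1 (4 * (Y i₁ * Z i₁)) := by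
  have h1 := ((mem_subBox.mp hu) i₁).2 hi
  have h2 := ((mem_subBox.mp hv) i₁).2 hi
  have hu0 : 0 < u i₁ := by omega
  have hv0 : 0 < v i₁ := by omega
  have hpos := Nat.mul_pos hu0 hv0
  rw [mem_Icc]
  constructor
  · omega
  · calc u i₁ * v i₁ ≤ (2 * Y i₁) * (2 * Z i₁) := Nat.mul_le_mul h1.2.le h2.2.le
      _ = 4 * (Y i₁ * Z i₁) := by ring

/-- A unit `c · offVal_{i₀}(u)` mod `q` has unit coordinate `u(i₁)`. [folklore] -/
theorem de_coprime_coord {d : ℕ} {i₀ i₁ : Fin d} (hi : i₁ ∉ ({i₀} : Finset (Fin d)))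
    {q c : ℕ} {u : Fin d → ℕ} (h : Nat.Coprime q (c * offVal {i₀} u)) : Nat.Coprime q (u i₁) :=
  Nat.Coprime.coprime_dvd_right ((dvd_offVal {i₀} u hi).mul_left c) h

/-- A unit `c · offVal_{i₀}(u)` mod `q` has unit part `c · offVal_{i₀,i₁}(frozen u)`. [folklore] -/
theorem de_coprime_offVal_pair {d : ℕ} {i₀ i₁ : Fin d} (X : Fin d → ℕ) (h0 : (i₀ : ℕ) = 0)
    (h1 : (i₁ : ℕ) = 1) {q c : ℕ} {u : Fin d → ℕ} (h : Nat.Coprime q (c * offVal {i₀} u)) :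
    Nat.Coprime q (c * offVal ({i₀, i₁} : Finset (Fin d)) (freezeOn {i₁} X u)) := by
  refine Nat.Coprime.coprime_dvd_right ?_ h
  rw [de_offVal_pair_freezeOn, de_offVal_singleton_eq_sq_mul i₀ i₁ h0 h1 u]
  exact ⟨u i₁ ^ 2, by ring⟩

/-- A tuple is determined by its freezing at `i₁` and its `i₁`-coordinate. [folklore] -/
theorem de_eq_of_freezeOn_singleton_eq {d : ℕ} {i₁ : Fin d} {X u v : Fin d → ℕ}
    (h : freezeOn {i₁} X u = freezeOn {i₁} X v) (hi : u i₁ = v i₁) : u = v := by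
  funext i
  by_cases hii : i = i₁
  · rw [hii]; exact hi
  · have h' := congrFun h i
    simp only [freezeOn, mem_singleton, hii, if_false] at h'
    exact h'

/-- The fibres of `p ↦ ((A, Cp), (B, Dp))` have at most `τ(A) τ(B)` elements. [folklore] -/
theorem de_prodVars_fibre_card_le {d : ℕ} (i₁ : Fin d) (Y Z : Fin d → ℕ)
    (S : Finset (((Fin d → ℕ) × (Fin d → ℕ)) × ((Fin d → ℕ) × (Fin d → ℕ))))
    (g : (ℕ × ((Fin d → ℕ) × (Fin d → ℕ))) × (ℕ × ((Fin d → ℕ) × (Fin d → ℕ))))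
    (hA : g.1.1 ≠ 0) (hB : g.2.1 ≠ 0) :
    (S.filter (fun p : ((Fin d → ℕ) × (Fin d → ℕ)) × ((Fin d → ℕ) × (Fin d → ℕ)) =>
      ((p.2.1 i₁ * p.1.2 i₁, (freezeOn {i₁} Y p.2.1, freezeOn {i₁} Z p.1.2)),
        (p.1.1 i₁ * p.2.2 i₁, (freezeOn {i₁} Y p.1.1, freezeOn {i₁} Z p.2.2))) = g)).card ≤
      g.1.1.divisors.card * g.2.1.divisors.card := by
  calc _ ≤ (g.1.1.divisorsAntidiagonal ×ˢ g.2.1.divisorsAntidiagonal).card := by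
        refine card_le_card_of_injOn
          (fun p : ((Fin d → ℕ) × (Fin d → ℕ)) × ((Fin d → ℕ) × (Fin d → ℕ)) =>
            ((p.2.1 i₁, p.1.2 i₁), (p.1.1 i₁, p.2.2 i₁))) (fun p hp => ?_) (fun p hp p' hp' h => ?_)
        · obtain ⟨-, hpg⟩ := mem_filter.mp (mem_coe.mp hp)
          subst hpg
          exact mem_coe.mpr (mem_product.mpr ⟨Nat.mem_divisorsAntidiagonal.mpr ⟨rfl, hA⟩,
            Nat.mem_divisorsAntidiagonal.mpr ⟨rfl, hB⟩⟩)
        · obtain ⟨-, hpg⟩ := mem_filter.mp (mem_coe.mp hp)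
          obtain ⟨-, hpg'⟩ := mem_filter.mp (mem_coe.mp hp')
          have hh := hpg.trans hpg'.symm
          simp only [Prod.mk.injEq] at hh h
          exact Prod.ext
            (Prod.ext (de_eq_of_freezeOn_singleton_eq hh.2.2.1 h.2.1)
              (de_eq_of_freezeOn_singleton_eq hh.1.2.2 h.1.2))
            (Prod.ext (de_eq_of_freezeOn_singleton_eq hh.1.2.1 h.1.1)
              (de_eq_of_freezeOn_singleton_eq hh.2.2.2 h.2.2))
    _ = g.1.1.divisors.card * g.2.1.divisors.card := by
        rw [card_product, ← Nat.map_div_right_divisors, card_map, ← Nat.map_div_right_divisors,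
          card_map]

/-- **The multiplicative energy in product variables.**  With `A = r₂'(i₁) r₃(i₁)`,
`B = r₂(i₁) r₃'(i₁)` and the pairs frozen at `i₁`, the mixed energy
`#{m(r₂') n(r₃) ≡ m(r₂) n(r₃') (mod q), units}` is at most `Dτ²` times the number of
`((A, Cp), (B, Dp))` with `A² F(Cp) ≡ B² F(Dp) (mod q)` and the unit conditions. [folklore] -/
theorem de_energy_le_productVars : ∀ {d : ℕ} (i₀ i₁ : Fin d), (i₀ : ℕ) = 0 → (i₁ : ℕ) = 1 → ∀ (q c₂ c₃ : ℕ), 0 < q → 0 < c₂ → 0 < c₃ → ∀ (Y Z : Fin d → ℕ), (∀ j, 0 < Y j) → (∀ j, 0 < Z j) → ∀ {T Dτ : ℕ}, 4 * (Y i₁ * Z i₁) ≤ T → (∀ m : ℕ, m ≠ 0 → m ≤ T → m.divisors.card ≤ Dτ) → ((((subBox {i₀} Y ×ˢ subBox {i₀} Z) ×ˢ (subBox {i₀} Y ×ˢ subBox {i₀} Z)).filter (fun p : ((Fin d → ℕ) × (Fin d → ℕ)) × ((Fin d → ℕ) × (Fin d → ℕ)) => Nat.Coprime q (c₂ * offVal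 {i₀} p.1.1) ∧ Nat.Coprime q (c₃ * offVal {i₀} p.1.2) ∧ Nat.Coprime q (c₂ * offVal {i₀} p.2.1) ∧ Nat.Coprime q (c₃ * offVal {i₀} p.2.2) ∧ (q : ℤ) ∣ ((c₂ * offVal {i₀} p.2.1 * (c₃ * offVal {i₀} p.1.2) : ℕ) : ℤ) - ((c₂ * offVal {i₀} p.1.1 * (c₃ * offVal {i₀} p.2.2) : ℕ) : ℤ)))).card ≤ Dτ ^ 2 * ((((Finset.Icc 1 (4 * (Y i₁ * Z i₁)) ×ˢ (subBox ({i₀, i₁} : Finset (Fin d)) Y ×ˢ subBox ({i₀, i₁} : Finset (Fin d)) Z)) ×ˢ (Finset.Icc 1 (4 * (Y i₁ * Z i₁)) ×ˢ (subBox ({i₀, i₁} : Finset (Fin d)) Y ×ˢ subBox ({i₀, i₁} : Finset (Fin d)) Z))).filter (fun g : (ℕ × ((Fin d → ℕ) × (Fin d → ℕ))) × (ℕ × ((Fin d → ℕ) × (Fin d → ℕ))) => Nat.Coprime q g.2.1 ∧ Nat.Coprime q (c₂ * offVal ({i₀, i₁} : Finset (Fin d)) g.1.2.1 * (c₃ *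 offVal ({i₀, i₁} : Finset (Fin d)) g.1.2.2)) ∧ Nat.Coprime q (c₂ * offVal ({i₀, i₁} : Finset (Fin d)) g.2.2.1 * (c₃ * offVal ({i₀, i₁} : Finset (Fin d)) g.2.2.2)) ∧ (q : ℤ) ∣ ((g.1.1 ^ 2 * (c₂ * offVal ({i₀, i₁} : Finset (Fin d)) g.1.2.1 * (c₃ * offVal ({i₀, i₁} : Finset (Fin d)) g.1.2.2)) : ℕ) : ℤ) - ((g.2.1 ^ 2 * (c₂ * offVal ({i₀, i₁} : Finset (Fin d)) g.2.2.1 * (c₃ * offVal ({i₀, i₁} : Finset (Fin d)) g.2.2.2)) : ℕ) : ℤ)))).card := by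
  intro d i₀ i₁ h0 h1 q c₂ c₃ _hq _hc₂ _hc₃ Y Z _hY _hZ T Dτ hT hD
  have hi₁ : i₁ ∉ ({i₀} : Finset (Fin d)) := by
    rw [mem_singleton]; exact Fin.ne_of_val_ne (by omega)
  refine card_le_mul_card_image_of_maps_to
    (f := fun p : ((Fin d → ℕ) × (Fin d → ℕ)) × ((Fin d → ℕ) × (Fin d → ℕ)) =>
      ((p.2.1 i₁ * p.1.2 i₁, (freezeOn {i₁} Y p.2.1, freezeOn {i₁} Z p.1.2)),
        (p.1.1 i₁ * p.2.2 i₁, (freezeOn {i₁} Y p.1.1, freezeOn {i₁} Z p.2.2)))) ?_ (Dτ ^ 2) ?_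
  · -- the map lands in `G₀`
    intro p hp
    obtain ⟨hbox, hc11, hc12, hc21, hc22, hdvd⟩ := mem_filter.mp hp
    simp only [mem_product] at hbox
    obtain ⟨⟨h11, h12⟩, h21, h22⟩ := hbox
    refine mem_filter.mpr ⟨?_, ?_, ?_, ?_, ?_⟩
    · simp only [mem_product]
      exact ⟨⟨de_mul_mem_Icc hi₁ h21 h12, de_freezeOn_mem_subBox_pair h21,
          de_freezeOn_mem_subBox_pair h12⟩,
        de_mul_mem_Icc hi₁ h11 h22, de_freezeOn_mem_subBox_pair h11, de_freezeOn_mem_subBox_pair h22⟩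
    · exact Nat.Coprime.mul_right (de_coprime_coord hi₁ hc11) (de_coprime_coord hi₁ hc22)
    · exact Nat.Coprime.mul_right (de_coprime_offVal_pair Y h0 h1 hc21)
        (de_coprime_offVal_pair Z h0 h1 hc12)
    · exact Nat.Coprime.mul_right (de_coprime_offVal_pair Y h0 h1 hc11)
        (de_coprime_offVal_pair Z h0 h1 hc22)
    · rw [de_prodVars_identity i₀ i₁ h0 h1 c₂ c₃ Y Z p.2.1 p.1.2,
        de_prodVars_identity i₀ i₁ h0 h1 c₂ c₃ Y Z p.1.1 p.2.2] at hdvd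
      exact hdvd
  · -- each fibre has at most `Dτ²` elements
    intro g hg
    have hbox := (mem_filter.mp hg).1
    simp only [mem_product, mem_Icc] at hbox
    obtain ⟨⟨⟨hA1, hA2⟩, -, -⟩, ⟨hB1, hB2⟩, -, -⟩ := hbox
    refine (de_prodVars_fibre_card_le i₁ Y Z _ g (by omega) (by omega)).trans ?_
    rw [sq]
    exact Nat.mul_le_mul (hD _ (by omega) (by omega)) (hD _ (by omega) (by omega))

end Summit.ABC.ABC.Theorems.MazurKaneLaw
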